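import Summits.BirchSwinnertonDyer.BirchSwinnertonDyer.Theorems.ThetaPartnerAtTwoMazurTateCongruenceAtTwoTopDepletionPrimitiveOfIhara
import Summits.BirchSwinnertonDyer.BirchSwinnertonDyer.Theorems.ThetaPartnerAtTwoMazurTateCongruenceAtTwoRStubIharaSymbolModTwoNegDisc
import HarnessLib

/-!
# Crux `MazurTateCongruenceAtTwoTop` (stmt-BirchSwinnertonDyer-25797 = `MazurTateCongruenceAtTwoR` 21416) FROM THE PUBLISHED INPUTS ALONE:
# `PublishedInputsHeckeAtTwo (27435) → MazurTateCongruenceAtTwoTop (25797)` — the node child `CuspSpanEvenAtTwoOdd` (27436) is not needed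
# (width seat bsd-wall-tp2-p1-w3 g0; `--supports stmt-BirchSwinnertonDyer-25797`; composition only)

HONEST FRAMING. THEOREMS ONLY; the five named Literature facts (Eichler–Shimura period lattice of the depleted optimal quotient, Hecke
self-duality of `J₀(N)`-torsion, Buzzard 2000 mod-`2` multiplicity one, Serre 1972 supersingular decomposition image, Abbes–Ullmo Thm. A)
remain HYPOTHESES (cite-only, unproved in the tree): every theorem here is CONDITIONAL on them and on nothing else. BSD is not proved by
any of this; the crux item is not closed unconditionally.

COMPOSITION (all inputs landed, std axioms): the lead's `mazurTateCongruenceAtTwoTop_of_fourFacts_depletionPrimitiveNegDisc`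
(`…RDepletionPrimitive`, tp2-p1 g11) fed with the lead's plumbing `stub_depletionPrimitiveNegDisc_of_ihara` (`…TopDepletionPrimitiveOfIhara`)
and this seat's `stub_iharaSymbolModTwoNegDisc` (p631156: Ihara's lemma mod `2` in symbol form, via `eq_zero_of_dilationInvariant` ←
cell bsd-f2-manin's `relativeIharaShiftVanishingBar_holds`, + tp2-p1-w2 g3's `not_isEisensteinEigensystem_two_of_Δ_neg`). So the K1 crux of
route ThetaPartnerAtTwo holds GRANTED PRINT ONLY — no `μ`-statement, no spanning node (G′)_N, no research input.

References: R. Greenberg, V. Vatsal, Invent. Math. 142 (2000) Thm. (1.4), §3 (13); K. Ribet, Proc. ICM 1983 (1984) Thm. 4.1/4.3;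
A. Abbes, E. Ullmo, Compositio Math. 103 (1996) Thm. A; K. Buzzard, MRL 7 (2000) Prop. 2.4.
-/

-- justification: the `Summit.BirchSwinnertonDyer.BirchSwinnertonDyer.…` path repeats a component (route-file convention)
set_option linter.dupNamespace false
set_option autoImplicit false

noncomputable section

open Literature.NumberTheory.EllipticCurves Literature.NumberTheory.EllipticCurves.ModularForms

namespace Summit.BirchSwinnertonDyer.BirchSwinnertonDyer.Theorems.MazurTateCongruenceAtTwoR

/-- **The crux BY NAME from FOUR print facts + the period fact at `2`, nothing else.** [cite: GreenbergVatsal2000, Thm. (1.4) and §3 (13)]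
[cite: Ribet1984ICM, Thm. 4.3] -/
theorem mazurTateCongruenceAtTwoTop_of_fourFacts_periodTwo
    (hES : eichlerShimura_depletedOptimalQuotient_periodLattice_of_dvd) (hSD : heckeSelfDual_torsionBy_J0)
    (hBz : buzzard2000_multiplicityOne_gamma0) (hSe : serre1972_supersingular_decompositionSubgroup_image)
    (h2 : realPeriodRat_eq_unit_mul_plusPeriod_two) :
    Summit.BirchSwinnertonDyer.BirchSwinnertonDyer.Theses.ThetaPartnerAtTwo.MazurTateCongruenceAtTwoTop :=
  mazurTateCongruenceAtTwoTop_of_fourFacts_depletionPrimitiveNegDisc hES hSD hBz hSe h2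
    (stub_depletionPrimitiveNegDisc_of_ihara h2 stub_iharaSymbolModTwoNegDisc)

/-- **PUB⁵ form**: the crux BY NAME from Eichler–Shimura (depleted optimal quotient), Hecke self-duality, Buzzard 2000, Serre 1972 and
Abbes–Ullmo Thm. A — the five conjuncts of the route's HOLD bundle `PublishedInputsHeckeAtTwo`. [cite: AbbesUllmo1996, Thm. A]
[cite: GreenbergVatsal2000, Thm. (1.4) and §3 (13)] -/
theorem mazurTateCongruenceAtTwoTop_of_fiveFacts
    (hES : eichlerShimura_depletedOptimalQuotient_periodLattice_of_dvd) (hSD : heckeSelfDual_torsionBy_J0)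
    (hBz : buzzard2000_multiplicityOne_gamma0) (hSe : serre1972_supersingular_decompositionSubgroup_image)
    (hAU : abbesUllmo_not_dvd_maninConstant_of_not_dvd_level) :
    Summit.BirchSwinnertonDyer.BirchSwinnertonDyer.Theses.ThetaPartnerAtTwo.MazurTateCongruenceAtTwoTop :=
  mazurTateCongruenceAtTwoTop_of_fourFacts_periodTwo hES hSD hBz hSe
    (SkinnerUrban2014.realPeriodRat_eq_unit_mul_plusPeriod_two_fact_of_abbesUllmo hAU)

/-- **`PublishedInputsHeckeAtTwo → MazurTateCongruenceAtTwoTop`**: the split parent (item 25797) follows from its PUB⁵ child (item 27435)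
ALONE — the node child `CuspSpanEvenAtTwoOdd` (27436) of the split is not needed for K1. [cite: GreenbergVatsal2000, Thm. (1.4) and §3 (13)]
[cite: Ribet1984ICM, Thm. 4.3] -/
theorem mazurTateCongruenceAtTwoTop_of_publishedInputsHeckeAtTwo
    (hPUB : Summit.BirchSwinnertonDyer.BirchSwinnertonDyer.Theses.ThetaPartnerAtTwo.PublishedInputsHeckeAtTwo) :
    Summit.BirchSwinnertonDyer.BirchSwinnertonDyer.Theses.ThetaPartnerAtTwo.MazurTateCongruenceAtTwoTop :=
  mazurTateCongruenceAtTwoTop_of_fiveFacts hPUB.1 hPUB.2.1 hPUB.2.2.1 hPUB.2.2.2.1 hPUB.2.2.2.2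

/-- The glue `MazurTateCongruenceAtTwoTopGlue` (item 27437) once more, now WITHOUT using its node hypothesis. [cite: Ribet1984ICM, Thm. 4.3] -/
theorem mazurTateCongruenceAtTwoTopGlue_of_publishedInputs :
    Summit.BirchSwinnertonDyer.BirchSwinnertonDyer.Theses.ThetaPartnerAtTwo.MazurTateCongruenceAtTwoTopGlue :=
  fun hPUB _ ↦ mazurTateCongruenceAtTwoTop_of_publishedInputsHeckeAtTwo hPUB

/-- The twin `MazurTateCongruenceAtTwoR` (item 21416) BY NAME from the four facts + the period fact. [cite: GreenbergVatsal2000, §3 (13)] -/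
theorem mazurTateCongruenceAtTwoR_of_fourFacts_periodTwo
    (hES : eichlerShimura_depletedOptimalQuotient_periodLattice_of_dvd) (hSD : heckeSelfDual_torsionBy_J0)
    (hBz : buzzard2000_multiplicityOne_gamma0) (hSe : serre1972_supersingular_decompositionSubgroup_image)
    (h2 : realPeriodRat_eq_unit_mul_plusPeriod_two) :
    Summit.BirchSwinnertonDyer.BirchSwinnertonDyer.Theses.ThetaPartnerAtTwo.MazurTateCongruenceAtTwoR :=
  mazurTateCongruenceAtTwoTop_of_fourFacts_periodTwo hES hSD hBz hSe h2

/-- The twin `MazurTateCongruenceAtTwoR` (item 21416) BY NAME from the PUB⁵ bundle. [cite: GreenbergVatsal2000, §3 (13)] -/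
theorem mazurTateCongruenceAtTwoR_of_publishedInputsHeckeAtTwo
    (hPUB : Summit.BirchSwinnertonDyer.BirchSwinnertonDyer.Theses.ThetaPartnerAtTwo.PublishedInputsHeckeAtTwo) :
    Summit.BirchSwinnertonDyer.BirchSwinnertonDyer.Theses.ThetaPartnerAtTwo.MazurTateCongruenceAtTwoR :=
  mazurTateCongruenceAtTwoTop_of_publishedInputsHeckeAtTwo hPUB

end Summit.BirchSwinnertonDyer.BirchSwinnertonDyer.Theorems.MazurTateCongruenceAtTwoR

end
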